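import Literature.AnabelianGeometry.EtaleTheta.TemperedFrobenioidToyDilating
import Literature.AnabelianGeometry.EtaleTheta.TemperedFrobenioidProps
import Literature.AnabelianGeometry.EtaleTheta.Discharge.Sec3Example39DataNonVacuity
import Literature.AlgebraicGeometry.Frobenioids.ElementaryFrobeniusCompact
import HarnessLib

/-!
# [EtTh] Remark 3.6.2 «`Φ^{bs-fld}` is always non-dilating» as typed over the tree's GENUINE [FrdI]
# vocabularies: the universal closure is FALSE — a Def. 3.6 (ii) inhabitant over `treeMonoidVocab` /
# `treeCatVocab` whose base automorphism `2` SQUARES `Φ^{bs-fld}` (kernel certificate)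

S. Mochizuki, *The étale theta function and its Frobenioid-theoretic manifestations*, Publ. RIMS **45**
(2009) [MochizukiEtTh2009], §3, Remark 3.6.2, PDF p. 78 (printed 304): "`Φ^{bs-fld}` is always non-dilating
and strictly rational" [cite: MochizukiEtTh2009, Rmk 3.6.2 p.78]; [FrdI] Def. 1.1 (i)/(ii) (non-dilating
endomorphisms of a monoid / of a monoid on a category) [cite: MochizukiFrdI2008, Def. 1.1 (i) p.19].

abc-iut cell, block F (FACT-LIST fact-proving wave), seat abc-iut-f-138 (tranche 138), row **F-1311**
`TemperedFrobenioid.Remark362` of `TemperedFrobenioidProps.lean` (abc-iut-L2-t3): the named `Prop`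
`VD.IsStrictlyRational C₀.bsFldMonoid ∧ ∀ A (f : A ⟶ A), V.IsNonDilating _ (C₀.bsFld.pull f)`, parametrised by
a tempered Frobenioid `C₀ : TemperedFrobenioid T D VD` and the two [FrdI] VOCABULARIES `V : FrdIMonoidStub`,
`VD : FrdICatStub D`.  abc-iut-f-049 refuted its universal closure through the FREE category-vocabulary stub
(`IsStrictlyRational := ⊥`, `TemperedFrobenioid.not_forall_remark362`, `TemperedFrobenioidPropsSchemaNegative.lean`),
which leaves open whether conjunct 2 — the part of the Remark the tree CAN read, through the canonical
vocabulary `treeMonoidVocab.IsNonDilating = Frobenioids.IsNonDilating` of `FrdIVocabulary.lean` — follows from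
the typed Def. 3.3 (iii) / 3.6 (i) / 3.6 (ii) interfaces.  THIS FILE decides it: **no**.

What the kernel certifies.  Over abc-iut-f-015's Def. 3.3 (iii) data `DilatingToy.divisorMonoids`
(`TemperedFrobenioidToyDilating.lean`: base `D₀ = SingleObj ℚ_{>0}`, `Φ₀ = ℚ_{≥0}` on which `u ∈ ℚ_{>0}` acts
by `q ↦ u·q`, `B₀ = Φ₀^gp`, `div₀ = id`, `F₀ = B₀` — every log-meromorphic function "constant") we form the
GENUINE Def. 3.6 (i) data `RealifiedDivisorMonoids.ofRlfZ` (abc-iut-L6-t12: `Φ₀^ℝ := Φ₀^rlf` the real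
realification functor, `ℝ·Φ₀^cnst :=` the genuine `ℝ`-span; `ℚ_{≥0}` is monoprime hence perf-factorial) over
`treeMonoidVocab`, and on it the Def. 3.6 (ii) structure `DilatingToyGenuine.C R S` over `treeCatVocab _ R S`
(for EVERY choice of the two still-free [FrdI] Def. 4.5 (ii) parameters `R`, `S`) with `D := D₀`,
`Φ := im(Φ₀^pf → Φ₀^rlf)` — group-saturated, perf-factorial and a divisorial monoid on `D` in the TREE's
sense by the generic lemmas of abc-iut-w5-d164's `Sec3Example39DataNonVacuity.lean` / abc-iut-found's
`isMonoidOn_of_bijective` (every arrow of the base is invertible) —, `Φ^{bs-fld} = Φ` (every divisor is the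
divisor of a constant) monoprime, and Def. 3.6 (ii)(b) witnessed by the constant `1 ∈ ℚ = B₀`.  The pull-back
along the base automorphism `2 ∈ ℚ_{>0}` is `ι(a) ↦ ι(a)²` on `Φ^{bs-fld} = ι(ℚ_{≥0}^pf)`:

* `DilatingToyGenuine.pull_two_apply` — `2^*(x) = x·x` on `Φ^{bs-fld}(A)`;
* `not_isNonDilating_of_sq` — in a sharp cancellative monoid with a non-trivial element the squaring
  endomorphism is dilating ([FrdI] Def. 1.1 (i): `a² ≼ a` for all `a`, yet `a² ≠ a`);
* **`DilatingToyGenuine.not_isNonDilating_bsFld_pull_two`**, **`DilatingToyGenuine.not_remark362`** —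
  conjunct 2 of `Remark362` FAILS at `C R S` for the tree's REAL predicate `Frobenioids.IsNonDilating`;
* **`TemperedFrobenioid.not_forall_isNonDilating_bsFld_treeVocab`**,
  **`TemperedFrobenioid.not_forall_remark362_treeVocab`** — the universal closures over tempered Frobenioids
  AT THE CANONICAL VOCABULARIES (`V := treeMonoidVocab`, `VD := treeCatVocab D R S`, all `R S`) are false.

Reading (cell vocabulary, R5).  Print's reason for Remark 3.6.2 is that pull-backs along morphisms of
tempered coverings act TRIVIALLY on the log-divisors of constants (`ℝ·Φ₀^cnst(Y) = ℝ·div(ϖ)`), a property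
of the geometric Def. 3.3 (iii) data that the typed interface `RealifiedDivisorMonoids` does not record
(`cnstR_map` says only that `ℝ·Φ₀^cnst` is pull-back STABLE) — the same interface-level binder genre as
`hKfix` / `hLine` of the [EtTh] Thm. 3.7 sub-DAG (GAP-LEDGER G-w5d250-1, G-w5d124-2).  So F-1311 is
admissible only at instances carrying that property: the conditional / toy instance forms are in the
proof-only companion `Discharge/Sec3Remark362.lean` (this seat).  HONEST FRAMING: a SCHEMA gap of OUR typed
interfaces over a DEGENERATE one-object geometry; it says nothing about the tempered Frobenioid of a curve
or about [EtTh] Remark 3.6.2 as printed; refereed pre-IUT material; nothing here bears on [IUTchIII]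
Cor. 3.12; no side taken; a FACT row is an assumption label, "refuted/proved" = this kernel check only.
-/

noncomputable section

namespace Literature.AnabelianGeometry.EtaleTheta

open CategoryTheory Opposite Literature.AlgebraicGeometry.Frobenioids

/-! ### A general [FrdI] Def. 1.1 (i) lemma: squaring is dilating -/

/-- **Squaring is dilating.**  In a sharp, cancellative commutative monoid `N` possessing an element
`x ≠ 1`, an endomorphism `φ` with `φ(a) = a·a` is NOT non-dilating in the sense of [FrdI] Def. 1.1 (i):
`φ^char(a) = a² ≼ a` for every `a` (so the hypothesis of "non-dilating" is met), but `φ^char ≠ id` since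
`x² = x·u`, `u` a unit, forces `x = 1`. [cite: MochizukiFrdI2008, Def. 1.1 (i) p.19] -/
theorem not_isNonDilating_of_sq {N : Type*} [CommMonoid N] [IsCancelMul N] (hN : IsSharp N) (φ : N →* N)
    (hφ : ∀ a : N, φ a = a * a) {x : N} (hx : x ≠ 1) : ¬ IsNonDilating φ := by
  intro hnd
  have H : ∀ a : Associates N, IsPrimary a → associatesMap φ a ≼ a := by
    intro a _
    obtain ⟨b, rfl⟩ := Associates.mk_surjective a
    exact ⟨2, two_pos, dvd_of_eq (by rw [associatesMap_mk, hφ, pow_two, Associates.mk_mul_mk])⟩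
  have h1 := DFunLike.congr_fun (hnd H) (Associates.mk x)
  rw [associatesMap_mk, MonoidHom.id_apply, Associates.mk_eq_mk_iff_associated] at h1
  obtain ⟨u, hu⟩ := h1
  rw [hN.1 (u : N) u.isUnit, mul_one, hφ] at hu
  exact hx (mul_left_cancel (hu.trans (mul_one x).symm))

namespace DilatingToyGenuine

open DilatingToy Example39NV

/-! ### §1 The genuine Def. 3.6 (i) data over abc-iut-f-015's Def. 3.3 (iii) data `Φ₀ = ℚ_{≥0}` -/

/-- `Φ₀(Y) = ℚ_{≥0}` is monoprime (`ℚ`-monoprime, [FrdI] §0 p. 10). [cite: MochizukiFrdI2008, §0 p.10] -/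
theorem isMonoprime_Φ₀ (Y : Baseᵒᵖ) : IsMonoprime (divisorMonoids.Φ₀.obj Y) :=
  IsMonoprime.ofQ ⟨⟨MulEquiv.refl _⟩⟩

/-- `Φ₀(Y) = ℚ_{≥0}` is perf-factorial in the tree's sense (monoprime ⇒ perf-factorial) — Prop. 3.4 (i)'s
conclusion at the toy. [cite: MochizukiEtTh2009, Prop 3.4 p.74] -/
theorem isPerfFactorial_Φ₀ (Y : Baseᵒᵖ) : IsPerfFactorial (divisorMonoids.Φ₀.obj Y) :=
  MonoprimeStructure.isPerfFactorial (isMonoprime_Φ₀ Y)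

/-- **Def. 3.6 (i) data over the GENUINE monoid vocabulary**: abc-iut-L6-t12's constructor `ofRlfZ` at
`DilatingToy.divisorMonoids` — `Φ₀^ℝ = ℚ_{≥0}^rlf` (the real realification functor, with the induced action
of `ℚ_{>0}`), `B₀^ℤ = B₀ = ℚ`, `F₀^ℤ = F₀ = B₀`, `ℝ·Φ₀^cnst` the genuine `ℝ`-span.
[cite: MochizukiEtTh2009, Def 3.6 p.76] -/
abbrev realifiedGenuine : RealifiedDivisorMonoids (D₀ := Base) treeMonoidVocab.{0} :=
  RealifiedDivisorMonoids.ofRlfZ divisorMonoids isPerfFactorial_Φ₀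

/-- `Φ(Y) := im(Φ₀(Y)^pf → Φ₀(Y)^rlf) ⊆ Φ^{ℝ-log}(Y)`. [cite: MochizukiEtTh2009, Def 3.6 p.76] -/
def pfImage (Y : Baseᵒᵖ) : Submonoid (realifiedGenuine.ΦR.obj Y) :=
  MonoidHom.mrange (isPerfFactorial_Φ₀ Y).toRealification

/-- Membership in `Φ(Y)`. [cite: MochizukiEtTh2009, Def 3.6 p.76] -/
theorem mem_pfImage_iff (Y : Baseᵒᵖ) (x : realifiedGenuine.ΦR.obj Y) :
    x ∈ pfImage Y ↔ ∃ a, (isPerfFactorial_Φ₀ Y).toRealification a = x := Iff.rfl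

/-- `Φ(Y)` is monoprime (`≅ ℚ_{≥0}^pf ≅ ℚ_{≥0}`). [cite: MochizukiEtTh2009, Def 3.6 p.77] -/
theorem isMonoprime_pfImage (Y : Baseᵒᵖ) : IsMonoprime ↥(pfImage Y) :=
  isMonoprime_mrange_toRealification (isMonoprime_Φ₀ Y)

/-- Every element of `(Φ^{ℝ-log})^gp(Y)` coming from `Φ(Y)` lies in `ℝ·Φ₀^cnst(Y)`: at the toy every
log-meromorphic function is constant (`F₀ = B₀ = Φ₀^gp`, `div₀ = id`), so `of a ∈ Φ₀^cnst ⊆ ℝ·Φ₀^cnst` for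
`a ∈ Φ₀(Y)`, and `ℝ·Φ₀^cnst` is root-closed, so the image of `Φ₀^pf` is base-field-theoretic too.
[cite: MochizukiEtTh2009, Def 3.6 p.77] -/
theorem of_mem_cnstR_of_mem_pfImage (Y : Baseᵒᵖ) {x : realifiedGenuine.ΦR.obj Y} (hx : x ∈ pfImage Y) :
    Algebra.GrothendieckGroup.of x ∈ realifiedGenuine.cnstR Y := by
  obtain ⟨a, rfl⟩ := hx
  obtain ⟨⟨m, n⟩, rfl⟩ := Perfection.mk_surjective a
  apply realifiedGenuine.mem_cnstR_of_pow_mem Y n.ne_zero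
  rw [← map_pow, ← map_pow, Perfection.mk_pow_self]
  -- `of m ∈ B₀(Y) = Φ₀(Y)^gp` is a constant function (`F₀ = ⊤`) with divisor `div₀ (of m) = of m`
  have key : EtaleTheta.gpMap (realifiedGenuine.toR Y)
      (realifiedGenuine.div₀ Y (Algebra.GrothendieckGroup.of m)) ∈ realifiedGenuine.cnstR Y :=
    realifiedGenuine.cnst_le_cnstR Y _ (Submonoid.mem_top _)
  have hb : realifiedGenuine.div₀ Y (Algebra.GrothendieckGroup.of m) =
      (Algebra.GrothendieckGroup.of m : Algebra.GrothendieckGroup (realifiedGenuine.Φ₀.obj Y)) := rfl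
  rw [hb, EtaleTheta.gpMap_of] at key
  exact key

/-- Hence `Φ(Y) ∩ (ℝ·Φ₀^cnst)(Y) = Φ(Y)` ("`Φ^{bs-fld} = Φ`" at the toy). [cite: MochizukiEtTh2009, Def 3.6 p.77] -/
theorem pfImage_inf_cnstR_eq (Y : Baseᵒᵖ) :
    pfImage Y ⊓ (realifiedGenuine.cnstR Y).toSubmonoid.comap Algebra.GrothendieckGroup.of = pfImage Y :=
  inf_eq_left.mpr fun _ hx => of_mem_cnstR_of_mem_pfImage Y hx

/-- The element `ι(1) := ι(of 1) ∈ Φ(Y)` (`1 ∈ ℚ_{≥0}` additively) is not the unit (`ℚ_{≥0}^pf ↪ ℚ_{≥0}^rlf`,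
and `ℚ_{≥0}` is sharp). [cite: MochizukiEtTh2009, Def 3.6 p.77] -/
theorem toRealification_of_ofAdd_one_ne_one (Y : Baseᵒᵖ) :
    (isPerfFactorial_Φ₀ Y).toRealification (Perfection.of _ (Multiplicative.ofAdd (1 : NNRat))) ≠ 1 := by
  intro h
  have h1 := toRealification_injective (isPerfFactorial_Φ₀ Y) (h.trans (map_one _).symm)
  rw [Perfection.of_apply,
    Perfection.mk_eq_one_iff_of_isSharp (MonoprimeStructure.isSharp (isMonoprime_Φ₀ Y))] at h1
  have h2 : (Multiplicative.ofAdd (1 : NNRat) : Multiplicative NNRat) = 1 := h1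
  exact one_ne_zero (ofAdd_eq_one.mp h2)

/-! ### §2 The divisor monoid `Φ := im(Φ₀^pf → Φ₀^rlf)` and the Def. 3.6 (ii) structure -/

/-- `Φ ⊆ Φ^{ℝ-log} := Φ₀^ℝ|_D` over the identity base functor: `A ↦ im(Φ₀^pf → Φ₀^rlf)`, stable under
pull-back (`Φ₀(f)^rlf ∘ ι = ι ∘ Φ₀(f)^pf`). [cite: MochizukiEtTh2009, Def 3.6 p.76] -/
def genuineΦ : SubMonoidOn ((𝟭 Base).op ⋙ realifiedGenuine.ΦR) where
  carrier A := pfImage A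
  map_mem := by
    rintro A B f _ ⟨a, rfl⟩
    refine ⟨Perfection.map (divisorMonoids.Φ₀.map f).hom a, ?_⟩
    have h := DFunLike.congr_fun (rlfMap_comp_toRealification divisorMonoids.Φ₀ isPerfFactorial_Φ₀ f) a
    simp only [MonoidHom.comp_apply] at h
    exact h.symm

/-- `Φ(A)` is `pfImage A`. [cite: MochizukiEtTh2009, Def 3.6 p.76] -/
@[simp] theorem genuineΦ_carrier (A : Baseᵒᵖ) : genuineΦ.carrier A = pfImage A := rfl

/-- Every pull-back of `Φ` is bijective: every arrow of the base `SingleObj ℚ_{>0}` is invertible, so the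
functor `Φ` carries it to an isomorphism of monoids. [cite: MochizukiFrdI2008, Def. 1.1 (ii) p.19] -/
theorem pull_bijective {A B : Base} (f : B ⟶ A) : Function.Bijective (pull genuineΦ.toFunctor f) := by
  haveI := isIso_base f
  exact (asIso (genuineΦ.toFunctor.map f.op)).commMonCatIsoToMulEquiv.bijective

/-- `Φ` is a monoid on the base in the tree's sense ([FrdI] Def. 1.1 (ii): bijective pull-backs are
characteristically injective and invert FSM-morphisms). [cite: MochizukiFrdI2008, Def. 1.1 (ii) p.19] -/
theorem isMonoidOn_genuineΦ : IsMonoidOn genuineΦ.toFunctor :=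
  isMonoidOn_of_bijective fun f => pull_bijective f

variable (R S : (Baseᵒᵖ ⥤ CommMonCat.{0}) → Prop)

/-- **Def. 3.6 (ii) data over the GENUINE vocabularies on the dilating base** — the tempered Frobenioid
structure on `(D := SingleObj ℚ_{>0} → D₀, Φ := im(Φ₀^pf → Φ₀^rlf))` over `ofRlfZ DilatingToy.divisorMonoids`:
`D` connected and totally epimorphic; `Φ` group-saturated in `Φ^{ℝ-log}` and perf-factorial (generic lemmas
of `Sec3Example39DataNonVacuity.lean`), a divisorial monoid on `D` in the TREE's sense (`IsMonoidOn` ∧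
objectwise `IsDivisorial`: monoprime ⇒ divisorial); (a) `Φ^{bs-fld} = Φ` monoprime; (b) the constant
`1 ∈ ℚ = F₀` has divisor `ι(1)/1 ≠ 1`.  `R`, `S` = the [FrdI] Def. 4.5 parameters of `treeCatVocab`.
[cite: MochizukiEtTh2009, Def 3.6 p.77] -/
def C : TemperedFrobenioid realifiedGenuine Base (treeCatVocab Base R S) where
  isConnected := DilatingToy.C.isConnected
  isTotallyEpimorphic := DilatingToy.C.isTotallyEpimorphic
  base := 𝟭 _
  Φ := genuineΦ
  isGroupSaturated A := isGroupSaturated_mrange_toRealification (isPerfFactorial_Φ₀ A)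
  isPerfFactorial A := isPerfFactorial_mrange_toRealification (isMonoprime_Φ₀ A)
  isDivisorialOn := by
    rw [treeCatVocab_isDivisorialOn]
    exact ⟨isMonoidOn_genuineΦ, fun A => MonoprimeStructure.isDivisorial (isMonoprime_pfImage (op A))⟩
  isMonoprime_bsFld A :=
    IsMonoprime.of_mulEquiv (MulEquiv.submonoidCongr (pfImage_inf_cnstR_eq A).symm) (isMonoprime_pfImage A)
  exists_FΛ_div_ne A := by
    refine ⟨Algebra.GrothendieckGroup.of (Multiplicative.ofAdd (1 : NNRat)), Submonoid.mem_top _,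
      (isPerfFactorial_Φ₀ A).toRealification (Perfection.of _ (Multiplicative.ofAdd (1 : NNRat))),
      ⟨_, rfl⟩, 1, one_mem _, toRealification_of_ofAdd_one_ne_one A, ?_⟩
    show EtaleTheta.gpMap (realifiedGenuine.toR A)
      (Algebra.GrothendieckGroup.of (Multiplicative.ofAdd (1 : NNRat))) = _
    rw [map_one, div_one, EtaleTheta.gpMap_of]
    rfl

/-- `Φ` of the structure is `pfImage`. [cite: MochizukiEtTh2009, Def 3.6 p.77] -/
@[simp] theorem C_Φ_carrier (A : Baseᵒᵖ) : (C R S).Φ.carrier A = pfImage A := rfl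

/-- `Φ^{bs-fld}(A)` of the structure has carrier `Φ(A) ∩ (ℝ·Φ₀^cnst)(A)` (`= Φ(A)`).
[cite: MochizukiEtTh2009, Def 3.6 p.77] -/
theorem mem_bsFld_carrier_iff (A : Baseᵒᵖ) (x : (C R S).ΦRlog.obj A) :
    x ∈ (C R S).bsFld.carrier A ↔ x ∈ pfImage A :=
  ⟨fun h => h.1, fun h => ⟨h, of_mem_cnstR_of_mem_pfImage A h⟩⟩

/-! ### §3 The base automorphism `2` pulls `Φ^{bs-fld}` back by SQUARING -/

/-- The action of `2 ∈ ℚ_{>0}` on `Φ₀ = ℚ_{≥0}` is doubling, i.e. squaring in multiplicative notation.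
[cite: MochizukiEtTh2009, Def 3.6 p.76] -/
theorem scale_two_apply (m : M) : scale (show NNRatˣ from two) m = m * m := by
  rw [scale_apply]
  change Multiplicative.ofAdd ((2 : NNRat) * Multiplicative.toAdd m) = m * m
  rw [two_mul, ofAdd_add, ofAdd_toAdd]

/-- `Φ₀(2)^pf` is squaring on `ℚ_{≥0}^pf` (`(2·m)^{1/n} = (m^{1/n})²`). [cite: MochizukiFrdI2008, §0 p.11] -/
theorem perfection_map_scale_two_apply (a : Perfection M) :
    Perfection.map (scale (show NNRatˣ from two)) a = a * a := by
  obtain ⟨⟨m, n⟩, rfl⟩ := Perfection.mk_surjective a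
  rw [Perfection.map_mk, scale_two_apply, ← pow_two, ← Perfection.mk_pow, pow_two]

/-- `Φ₀(2)^rlf (ι a) = ι(a)·ι(a)`: the realified pull-back along `2` squares the image of `Φ₀^pf`
(`Φ₀(2)^rlf ∘ ι = ι ∘ Φ₀(2)^pf`, the defining property of abc-iut-L2-d2's realification functor).
[cite: MochizukiFrdI2008, Prop. 5.3 p.103] -/
theorem rlfMap_two_toRealification (a : Perfection (divisorMonoids.Φ₀.obj (op (SingleObj.star NNRatˣ)))) :
    rlfMap divisorMonoids.Φ₀ isPerfFactorial_Φ₀ (two.op : op (SingleObj.star NNRatˣ) ⟶ _)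
        ((isPerfFactorial_Φ₀ (op (SingleObj.star NNRatˣ))).toRealification a) =
      (isPerfFactorial_Φ₀ (op (SingleObj.star NNRatˣ))).toRealification a *
        (isPerfFactorial_Φ₀ (op (SingleObj.star NNRatˣ))).toRealification a := by
  have h := DFunLike.congr_fun
    (rlfMap_comp_toRealification divisorMonoids.Φ₀ isPerfFactorial_Φ₀ (two.op : op (SingleObj.star NNRatˣ) ⟶ _)) a
  simp only [MonoidHom.comp_apply] at h
  have h2 : Perfection.map (divisorMonoids.Φ₀.map (two.op : op (SingleObj.star NNRatˣ) ⟶ _)).hom a = a * a :=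
    perfection_map_scale_two_apply a
  rw [h2, map_mul] at h
  exact h

/-- **`2^*(x) = x·x` on `Φ^{bs-fld}(A)`**: the pull-back along the base automorphism `2` squares every
base-field-theoretic divisor. [cite: MochizukiFrdI2008, Def. 1.1 (i) p.19] -/
theorem pull_two_apply (x : (C R S).bsFld.carrier (op (SingleObj.star NNRatˣ))) :
    (C R S).bsFld.pull two.op x = x * x := by
  apply Subtype.ext
  obtain ⟨a, ha⟩ := ((mem_bsFld_carrier_iff R S _ x.1).mp x.2)
  have hx : (x : (C R S).ΦRlog.obj (op (SingleObj.star NNRatˣ))) =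
      (isPerfFactorial_Φ₀ (op (SingleObj.star NNRatˣ))).toRealification a := ha.symm
  rw [SubMonoidOn.coe_pull, Submonoid.coe_mul, hx]
  exact rlfMap_two_toRealification a

/-- The base-field-theoretic divisor `ι(1) ∈ Φ^{bs-fld}(A)`, a non-trivial element.
[cite: MochizukiEtTh2009, Def 3.6 p.77] -/
def x₁ : (C R S).bsFld.carrier (op (SingleObj.star NNRatˣ)) :=
  ⟨(isPerfFactorial_Φ₀ (op (SingleObj.star NNRatˣ))).toRealification
      (Perfection.of _ (Multiplicative.ofAdd (1 : NNRat))),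
    (mem_bsFld_carrier_iff R S _ _).mpr ⟨_, rfl⟩⟩

/-- `ι(1) ≠ 1` in `Φ^{bs-fld}(A)`. [cite: MochizukiEtTh2009, Def 3.6 p.77] -/
theorem x₁_ne_one : x₁ R S ≠ 1 := fun h =>
  toRealification_of_ofAdd_one_ne_one (op (SingleObj.star NNRatˣ)) (congrArg Subtype.val h)

/-- **Conjunct 2 of Remark 3.6.2 FAILS at `C R S` for the tree's real predicate**: the pull-back of
`Φ^{bs-fld}` along the base automorphism `2` is squaring on the sharp cancellative monoid
`Φ^{bs-fld}(A) ≅ ℚ_{≥0}` with `ι(1) ≠ 1`, hence DILATING ([FrdI] Def. 1.1 (i)). [cite: MochizukiEtTh2009, Rmk 3.6.2 p.78] -/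
theorem not_isNonDilating_bsFld_pull_two :
    ¬ IsNonDilating ((C R S).bsFld.pull (two.op : op (SingleObj.star NNRatˣ) ⟶ _)) := by
  have hmono : IsMonoprime ((C R S).bsFld.carrier (op (SingleObj.star NNRatˣ))) :=
    (C R S).isMonoprime_bsFld (op (SingleObj.star NNRatˣ))
  haveI := MonoprimeStructure.isCancelMul hmono
  exact not_isNonDilating_of_sq (MonoprimeStructure.isSharp hmono) _ (pull_two_apply R S) (x₁_ne_one R S)

/-- **`Remark362` FAILS at `C R S`** (through conjunct 2, at the GENUINE monoid vocabulary — independently of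
the free Def. 4.5 (ii) parameters `R`, `S` of the category vocabulary). [cite: MochizukiEtTh2009, Rmk 3.6.2 p.78] -/
theorem not_remark362 : ¬ (C R S).Remark362 := fun h =>
  not_isNonDilating_bsFld_pull_two R S
    ((treeMonoidVocab_isNonDilating _ _).mp (h.2 (op (SingleObj.star NNRatˣ)) two.op))

end DilatingToyGenuine

/-! ### §4 The universal closures at the canonical vocabularies -/

namespace TemperedFrobenioid

/-- **Conjunct 2 of F-1311 is not a consequence of the typed Def. 3.6 interfaces, even read with the
tree's real [FrdI] predicates**: it is false that for every Def. 3.6 (i) datum `T` over `treeMonoidVocab`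
and every tempered Frobenioid `C₀` over `treeCatVocab D R S` all pull-backs of `Φ^{bs-fld}` along base
endomorphisms are non-dilating (witness `DilatingToyGenuine.C`: the automorphism `2` squares `Φ^{bs-fld}`).
The missing input is print's "pull-backs act trivially on the log-divisors of constants" (cf.
`Discharge/Sec3Remark362.lean`). [cite: MochizukiEtTh2009, Rmk 3.6.2 p.78] -/
theorem not_forall_isNonDilating_bsFld_treeVocab :
    ¬ ∀ (D₀ : Type) (_ : Category.{0} D₀) (T : RealifiedDivisorMonoids (D₀ := D₀) treeMonoidVocab.{0})
        (D : Type) (_ : Category.{0} D) (R S : (Dᵒᵖ ⥤ CommMonCat.{0}) → Prop)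
        (C₀ : TemperedFrobenioid T D (treeCatVocab D R S)) (A : Dᵒᵖ) (f : A ⟶ A),
        IsNonDilating (C₀.bsFld.pull f) := fun h =>
  DilatingToyGenuine.not_isNonDilating_bsFld_pull_two (fun _ => True) (fun _ => True)
    (h _ _ _ _ _ _ _ (DilatingToyGenuine.C _ _) _ _)

/-- **The universal closure of F-1311 at the canonical vocabularies is false**: `Remark362` fails for some
tempered Frobenioid over `treeMonoidVocab` / `treeCatVocab D R S`, for EVERY reading `R`, `S` of the two
[FrdI] Def. 4.5 (ii) predicates (so in particular for the genuine ones, once landed) — the failure is in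
conjunct 2 "`Φ^{bs-fld}` is always non-dilating", read through `Frobenioids.IsNonDilating`.  (abc-iut-f-049's
`not_forall_remark362` refutes the closure over ARBITRARY vocabularies through conjunct 1's free stub; this is
the complementary statement for the vocabulary the tree actually means.) [cite: MochizukiEtTh2009, Rmk 3.6.2 p.78] -/
theorem not_forall_remark362_treeVocab :
    ¬ ∀ (D₀ : Type) (_ : Category.{0} D₀) (T : RealifiedDivisorMonoids (D₀ := D₀) treeMonoidVocab.{0})
        (D : Type) (_ : Category.{0} D) (R S : (Dᵒᵖ ⥤ CommMonCat.{0}) → Prop)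
        (C₀ : TemperedFrobenioid T D (treeCatVocab D R S)), C₀.Remark362 := fun h =>
  DilatingToyGenuine.not_remark362 (fun _ => True) (fun _ => True) (h _ _ _ _ _ _ _ (DilatingToyGenuine.C _ _))

/-- The same with the Def. 4.5 (ii) parameters quantified per instance: for EVERY `R`, `S` there is a
counterexample over `treeCatVocab _ R S`. [cite: MochizukiEtTh2009, Rmk 3.6.2 p.78] -/
theorem exists_not_remark362_treeCatVocab (R S : ((SingleObj NNRatˣ)ᵒᵖ ⥤ CommMonCat.{0}) → Prop) :
    ∃ C₀ : TemperedFrobenioid DilatingToyGenuine.realifiedGenuine (SingleObj NNRatˣ)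
        (treeCatVocab (SingleObj NNRatˣ) R S), ¬ C₀.Remark362 :=
  ⟨DilatingToyGenuine.C R S, DilatingToyGenuine.not_remark362 R S⟩

end TemperedFrobenioid

end Literature.AnabelianGeometry.EtaleTheta

end
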